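import Mathlib
import Summits.Langlands.Langlands.Theorems.CapacityClassicalityCongruenceToClassicalQuotient

/-!
# Crux `HilbertIntegralOverconvergentIsCongruence` (stmt-Langlands-8485), line `Sketch-ideate-r1-k1`:
# the algebraization engine, `d = 1` — I. archimedean sizes and the Siegel count

Part I of the proof of the registered stub R8 `stub_algebraicMain` (RESHAPE 4 of the skeleton
`Cruxes/HilbertIntegralOverconvergentIsCongruence/Lines/Sketch_ideate_r1_k1.lean`):

* weighted `ℓ¹` sizes `W_t(φ) = Σ ‖φ_n‖ tⁿ` of complex power series: coefficient bound, powers (from the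
  product rule, stub R1, taken as a hypothesis), finiteness for `q`-expansions of level-one modular
  forms (radius `≥ 1`, Mathlib) and for radius-one sequences;
* `stub_archBound` (registered stub R8a) — the archimedean bound of the Schneider–Lang assembly:
  `‖coeff_ν(E₄^α E₆^β Δ^i · x^j)‖ ≤ B₀^{N₁} B_g^D e^{ην}` at `t = e^{-η}` when `W_t(E₄), W_t(E₆), W_t(Δ) ≤ B₀`,
  `W_t(x) ≤ B_g`, `α + β + i ≤ N₁`, `j ≤ D`;
* `algMain_counts` — the bookkeeping of the Siegel count (stub R6, taken as a hypothesis): weights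
  `b_j = 12uD - jk ∈ [0, 13uD]`, the unitriangular index sets `J(b)`, and the thresholds
  `N₀(D) = (#unknowns - 1)/2` with `m·D ≤ N₀(D)` for some `D ≥ 1`.

Theorems only, no `sorry`.
-/

set_option linter.dupNamespace false

noncomputable section

open scoped MatrixGroups NumberField

namespace Summit.Langlands.Langlands.Theorems.HilbertIntegralOverconvergentIsCongruence

/-! ### Weighted `ℓ¹` sizes of complex power series -/

/-- Coefficient bound from a finite weighted `ℓ¹` size: `‖φ_n‖ tⁿ ≤ Σ_m ‖φ_m‖ tᵐ`. [folklore] -/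
theorem algMain_norm_coeff_mul_pow_le (φ : PowerSeries ℂ) (t : ℝ) (ht : 0 ≤ t)
    (hφ : Summable fun n : ℕ ↦ ‖PowerSeries.coeff n φ‖ * t ^ n) (n : ℕ) :
    ‖PowerSeries.coeff n φ‖ * t ^ n ≤ ∑' m : ℕ, ‖PowerSeries.coeff m φ‖ * t ^ m :=
  hφ.le_tsum n fun m _ ↦ by positivity

/-- Weighted `ℓ¹` sizes of POWERS: if the size of `φ` is finite then so is that of `φ ^ m`, and it is
at most the `m`-th power of the size of `φ` (iterate the product rule `hR1`, stub R1). [folklore] -/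
theorem algMain_weighted_pow
    (hR1 : ∀ (φ ψ : PowerSeries ℂ) (t : ℝ), 0 ≤ t →
      (Summable fun n : ℕ ↦ ‖PowerSeries.coeff n φ‖ * t ^ n) →
      (Summable fun n : ℕ ↦ ‖PowerSeries.coeff n ψ‖ * t ^ n) →
      Summable (fun n : ℕ ↦ ‖PowerSeries.coeff n (φ * ψ)‖ * t ^ n) ∧
        ∑' n : ℕ, ‖PowerSeries.coeff n (φ * ψ)‖ * t ^ n ≤
          (∑' n : ℕ, ‖PowerSeries.coeff n φ‖ * t ^ n) * ∑' n : ℕ, ‖PowerSeries.coeff n ψ‖ * t ^ n)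
    (φ : PowerSeries ℂ) (t : ℝ) (ht : 0 ≤ t)
    (hφ : Summable fun n : ℕ ↦ ‖PowerSeries.coeff n φ‖ * t ^ n) (m : ℕ) :
    Summable (fun n : ℕ ↦ ‖PowerSeries.coeff n (φ ^ m)‖ * t ^ n) ∧
      ∑' n : ℕ, ‖PowerSeries.coeff n (φ ^ m)‖ * t ^ n ≤ (∑' n : ℕ, ‖PowerSeries.coeff n φ‖ * t ^ n) ^ m := by
  classical
  induction m with
  | zero =>
    have hfun : (fun n : ℕ ↦ ‖PowerSeries.coeff n ((φ : PowerSeries ℂ) ^ 0)‖ * t ^ n) =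
        fun n : ℕ ↦ if n = 0 then (1 : ℝ) else 0 := by
      funext n
      rw [pow_zero, PowerSeries.coeff_one]
      split_ifs with h
      · subst h; simp
      · simp
    rw [hfun]
    refine ⟨summable_of_ne_finset_zero (s := {0}) (fun n hn ↦ ?_), ?_⟩
    · rw [Finset.mem_singleton] at hn
      simp [hn]
    · rw [tsum_eq_single 0 (fun n hn ↦ if_neg hn), if_pos rfl, pow_zero]
  | succ m ih =>
    obtain ⟨hs, hle⟩ := ih
    obtain ⟨hs', hle'⟩ := hR1 (φ ^ m) φ t ht hs hφ
    refine ⟨by simpa [pow_succ] using hs', ?_⟩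
    rw [pow_succ, pow_succ]
    refine hle'.trans ?_
    have h0 : 0 ≤ ∑' n : ℕ, ‖PowerSeries.coeff n φ‖ * t ^ n :=
      tsum_nonneg fun n ↦ by positivity
    exact mul_le_mul_of_nonneg_right hle h0

/-- Weighted `ℓ¹` sizes of `q`-expansions of level-one modular forms are finite at every `0 ≤ t < 1`
(the `q`-expansion has radius of convergence `≥ 1`, Mathlib
`qExpansionFormalMultilinearSeries_radius`). [folklore] -/
theorem algMain_summable_qExpansion {k : ℤ} (F : ModularForm 𝒮ℒ k) (t : ℝ) (ht0 : 0 ≤ t)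
    (ht1 : t < 1) :
    Summable fun n : ℕ ↦ ‖PowerSeries.coeff n (UpperHalfPlane.qExpansion 1 ⇑F)‖ * t ^ n := by
  have hΓ : (1 : ℝ) ∈ (𝒮ℒ).strictPeriods := one_mem_strictPeriods_SL
  have hrad := UpperHalfPlane.qExpansionFormalMultilinearSeries_radius (f := F) one_pos
    (SlashInvariantFormClass.periodic_comp_ofComplex F hΓ) (ModularFormClass.holo F)
    (ModularFormClass.bdd_at_infty F)
  lift t to NNReal using ht0
  have hlt : ((t : NNReal) : ENNReal) < (UpperHalfPlane.qExpansionFormalMultilinearSeries 1 F).radius :=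
    lt_of_lt_of_le (by exact_mod_cast ht1) hrad
  have hs := FormalMultilinearSeries.summable_norm_mul_pow _ hlt
  simpa [UpperHalfPlane.qExpansionFormalMultilinearSeries_apply_norm] using hs

/-- Weighted `ℓ¹` sizes of radius-one sequences are finite: if `‖x_n‖ sⁿ` is bounded for every
`0 < s < 1` then `Σ ‖x_n‖ tⁿ < ∞` for every `0 ≤ t < 1`. [folklore] -/
theorem algMain_summable_of_radius (x : ℕ → ℂ)
    (hx : ∀ s : ℝ, 0 < s → s < 1 → ∃ C : ℝ, ∀ n, ‖x n‖ * s ^ n ≤ C) (t : ℝ) (ht0 : 0 ≤ t)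
    (ht1 : t < 1) : Summable fun n : ℕ ↦ ‖x n‖ * t ^ n := by
  have hq : ‖(t : ℂ)‖ < 1 := by
    rw [Complex.norm_real, Real.norm_eq_abs, abs_of_nonneg ht0]
    exact ht1
  have hs := CapacityClassicality.summable_norm_mul_pow_of_bound hx hq
  refine hs.congr fun n ↦ ?_
  rw [norm_mul, norm_pow, Complex.norm_real, Real.norm_eq_abs, abs_of_nonneg ht0]

/-! ### The archimedean bound (registered stub R8a) -/

/-- **Registered stub R8a (`stub_archBound`) of line `Sketch-ideate-r1-k1`.**  With the product rule
for weighted sizes (stub R1) as hypothesis: at `t₀ = e^{-η} ∈ (0,1)`, if the weighted sizes of the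
`q`-expansions of `E₄`, `E₆`, `Δ` are `≤ B₀` (`B₀ ≥ 1`) and `Σ ‖x_n‖ t₀ⁿ ≤ B_g` (`B_g ≥ 1`), then for
`α + β + i ≤ N₁` and `j ≤ D` every coefficient of `E₄^α E₆^β Δ^i · (Σ x_n qⁿ)^j` has norm
`≤ B₀^{N₁} B_g^D e^{ην}` (submultiplicativity, then `‖φ_ν‖ t₀^ν ≤ W_{t₀}(φ)`). [folklore] -/
theorem stub_archBound
    (hR1 : ∀ (φ ψ : PowerSeries ℂ) (t : ℝ), 0 ≤ t →
      (Summable fun n : ℕ ↦ ‖PowerSeries.coeff n φ‖ * t ^ n) →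
      (Summable fun n : ℕ ↦ ‖PowerSeries.coeff n ψ‖ * t ^ n) →
      Summable (fun n : ℕ ↦ ‖PowerSeries.coeff n (φ * ψ)‖ * t ^ n) ∧
        ∑' n : ℕ, ‖PowerSeries.coeff n (φ * ψ)‖ * t ^ n ≤
          (∑' n : ℕ, ‖PowerSeries.coeff n φ‖ * t ^ n) * ∑' n : ℕ, ‖PowerSeries.coeff n ψ‖ * t ^ n)
    (t₀ η : ℝ) (ht₀0 : 0 < t₀) (ht₀1 : t₀ < 1) (ht₀η : t₀ = Real.exp (-η))
    (B₀ Bg : ℝ) (hB₀1 : 1 ≤ B₀) (hBg1 : 1 ≤ Bg)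
    (hW₄ : ∑' n : ℕ, ‖PowerSeries.coeff n (UpperHalfPlane.qExpansion 1 ⇑ModularForm.E₄)‖ * t₀ ^ n ≤ B₀)
    (hW₆ : ∑' n : ℕ, ‖PowerSeries.coeff n (UpperHalfPlane.qExpansion 1 ⇑ModularForm.E₆)‖ * t₀ ^ n ≤ B₀)
    (hWΔ : ∑' n : ℕ, ‖PowerSeries.coeff n (UpperHalfPlane.qExpansion 1 ⇑CuspForm.discriminant)‖ * t₀ ^ n ≤ B₀)
    (x : ℕ → ℂ) (hx : Summable fun n : ℕ ↦ ‖x n‖ * t₀ ^ n) (hWx : ∑' n : ℕ, ‖x n‖ * t₀ ^ n ≤ Bg)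
    (α β i jj N₁ D : ℕ) (hαβi : α + β + i ≤ N₁) (hjj : jj ≤ D) (ν : ℕ) :
    ‖PowerSeries.coeff ν (UpperHalfPlane.qExpansion 1 ⇑ModularForm.E₄ ^ α *
        UpperHalfPlane.qExpansion 1 ⇑ModularForm.E₆ ^ β *
        UpperHalfPlane.qExpansion 1 ⇑CuspForm.discriminant ^ i * (PowerSeries.mk x) ^ jj)‖ ≤
      B₀ ^ N₁ * Bg ^ D * Real.exp (η * ν) := by
  -- products of finite weighted sizes
  have hWmul : ∀ (φ ψ : PowerSeries ℂ) (X Y : ℝ), 0 ≤ X →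
      (Summable fun n : ℕ ↦ ‖PowerSeries.coeff n φ‖ * t₀ ^ n) →
      (∑' n : ℕ, ‖PowerSeries.coeff n φ‖ * t₀ ^ n) ≤ X →
      (Summable fun n : ℕ ↦ ‖PowerSeries.coeff n ψ‖ * t₀ ^ n) →
      (∑' n : ℕ, ‖PowerSeries.coeff n ψ‖ * t₀ ^ n) ≤ Y →
      (Summable fun n : ℕ ↦ ‖PowerSeries.coeff n (φ * ψ)‖ * t₀ ^ n) ∧
        (∑' n : ℕ, ‖PowerSeries.coeff n (φ * ψ)‖ * t₀ ^ n) ≤ X * Y := by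
    intro φ ψ X Y hX hφ hφX hψ hψY
    obtain ⟨hs, hle⟩ := hR1 φ ψ t₀ ht₀0.le hφ hψ
    refine ⟨hs, hle.trans ?_⟩
    have h0 : 0 ≤ ∑' n : ℕ, ‖PowerSeries.coeff n ψ‖ * t₀ ^ n := tsum_nonneg fun n ↦ by positivity
    exact mul_le_mul hφX hψY h0 hX
  -- powers of finite weighted sizes
  have hWpow : ∀ (φ : PowerSeries ℂ) (X : ℝ) (m : ℕ), 0 ≤ X →
      (Summable fun n : ℕ ↦ ‖PowerSeries.coeff n φ‖ * t₀ ^ n) →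
      (∑' n : ℕ, ‖PowerSeries.coeff n φ‖ * t₀ ^ n) ≤ X →
      (Summable fun n : ℕ ↦ ‖PowerSeries.coeff n (φ ^ m)‖ * t₀ ^ n) ∧
        (∑' n : ℕ, ‖PowerSeries.coeff n (φ ^ m)‖ * t₀ ^ n) ≤ X ^ m := by
    intro φ X m hX hφ hφX
    obtain ⟨hs, hle⟩ := algMain_weighted_pow hR1 φ t₀ ht₀0.le hφ m
    refine ⟨hs, hle.trans ?_⟩
    exact pow_le_pow_left₀ (tsum_nonneg fun n ↦ by positivity) hφX m
  -- summability of the four factors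
  have hs₄ := algMain_summable_qExpansion ModularForm.E₄ t₀ ht₀0.le ht₀1
  have hs₆ := algMain_summable_qExpansion ModularForm.E₆ t₀ ht₀0.le ht₀1
  have hsΔ := algMain_summable_qExpansion (CuspForm.discriminant : ModularForm 𝒮ℒ 12) t₀ ht₀0.le ht₀1
  have hsx : Summable fun n : ℕ ↦ ‖PowerSeries.coeff n (PowerSeries.mk x)‖ * t₀ ^ n := by
    simpa only [PowerSeries.coeff_mk] using hx
  have hWx' : ∑' n : ℕ, ‖PowerSeries.coeff n (PowerSeries.mk x)‖ * t₀ ^ n ≤ Bg := by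
    simpa only [PowerSeries.coeff_mk] using hWx
  have hB₀0 : 0 ≤ B₀ := zero_le_one.trans hB₀1
  have hBg0 : 0 ≤ Bg := zero_le_one.trans hBg1
  obtain ⟨hp₄, hle₄⟩ := hWpow _ B₀ α hB₀0 hs₄ hW₄
  obtain ⟨hp₆, hle₆⟩ := hWpow _ B₀ β hB₀0 hs₆ hW₆
  obtain ⟨hpΔ, hleΔ⟩ := hWpow _ B₀ i hB₀0 hsΔ hWΔ
  obtain ⟨hpx, hlex⟩ := hWpow _ Bg jj hBg0 hsx hWx'
  obtain ⟨hs₁, hle₁⟩ := hWmul _ _ _ _ (pow_nonneg hB₀0 _) hp₄ hle₄ hp₆ hle₆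
  obtain ⟨hs₂, hle₂⟩ := hWmul _ _ _ _ (mul_nonneg (pow_nonneg hB₀0 _) (pow_nonneg hB₀0 _)) hs₁ hle₁ hpΔ hleΔ
  obtain ⟨hs₃, hle₃⟩ := hWmul _ _ _ _
    (mul_nonneg (mul_nonneg (pow_nonneg hB₀0 _) (pow_nonneg hB₀0 _)) (pow_nonneg hB₀0 _)) hs₂ hle₂ hpx hlex
  -- from the weighted size to the coefficient
  have hcoef : ∀ (φ : PowerSeries ℂ) (X : ℝ),
      (Summable fun n : ℕ ↦ ‖PowerSeries.coeff n φ‖ * t₀ ^ n) →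
      (∑' n : ℕ, ‖PowerSeries.coeff n φ‖ * t₀ ^ n) ≤ X → ‖PowerSeries.coeff ν φ‖ ≤ X * Real.exp (η * ν) := by
    intro φ X hφ hφX
    have h1 := (algMain_norm_coeff_mul_pow_le φ t₀ ht₀0.le hφ ν).trans hφX
    have ht : t₀ ^ ν * Real.exp (η * ν) = 1 := by
      rw [ht₀η, ← Real.exp_nat_mul, ← Real.exp_add]
      convert Real.exp_zero using 2
      ring
    have hexp : 0 < Real.exp (η * ν) := Real.exp_pos _
    calc ‖PowerSeries.coeff ν φ‖ = ‖PowerSeries.coeff ν φ‖ * t₀ ^ ν * Real.exp (η * ν) := by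
          rw [mul_assoc, ht, mul_one]
      _ ≤ X * Real.exp (η * ν) := mul_le_mul_of_nonneg_right h1 hexp.le
  have hbound : B₀ ^ α * B₀ ^ β * B₀ ^ i * Bg ^ jj ≤ B₀ ^ N₁ * Bg ^ D := by
    calc B₀ ^ α * B₀ ^ β * B₀ ^ i * Bg ^ jj = B₀ ^ (α + β + i) * Bg ^ jj := by rw [pow_add, pow_add]
      _ ≤ B₀ ^ N₁ * Bg ^ D :=
          mul_le_mul (pow_le_pow_right₀ hB₀1 hαβi) (pow_le_pow_right₀ hBg1 hjj) (pow_nonneg hBg0 _)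
            (pow_nonneg hB₀0 _)
  exact (hcoef _ _ hs₃ hle₃).trans (mul_le_mul_of_nonneg_right hbound (Real.exp_pos _).le)

/-! ### The Siegel count: weights, index sets, thresholds -/

/-- **Bookkeeping of the Siegel count** (stub R6 as the hypothesis `hR6`).  With `u = |k| + 1`,
weights `bw D j = 12uD - jk` (as naturals) and the unitriangular index sets `J b`: membership in
`J b` unpacked; `0 ≤ 12uD - jk` and `bw D j ≤ 13uD` for `j ≤ D`; and for the number of unknowns
`cardβ D = Σ_{j < D} #J(bw D j)`: `cardβ D ≥ 1` and `cardβ D ≤ (24u)^D` for `D ≥ 1`, and for every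
`m` some `D ≥ 1` has `m D ≤ (cardβ D - 1)/2`. [folklore] -/
theorem algMain_counts (k : ℤ) (u : ℕ) (hu : u = k.natAbs + 1) (J : ℕ → Finset ℕ)
    (hJ : ∀ b : ℕ, J b = if Even b then
      (Finset.range (b / 12 + 1)).filter (fun i ↦ b - 12 * i ≠ 2) else ∅)
    (bw : ℕ → ℕ → ℕ) (hbw : ∀ D jj : ℕ, bw D jj = (((12 * u * D : ℕ) : ℤ) - jj * k).toNat)
    (hR6 : (∀ D, 1 ≤ D → 1 ≤ ∑ j ∈ Finset.range (D + 1), (J (((12 * u * D : ℕ) : ℤ) - j * k).toNat).card) ∧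
      (∀ D, 1 ≤ D → ((∑ j ∈ Finset.range (D + 1),
        (J (((12 * u * D : ℕ) : ℤ) - j * k).toNat).card : ℕ) : ℝ) ≤ (24 * u : ℝ) ^ D) ∧
      (∀ m : ℕ, ∃ D, 1 ≤ D ∧ 2 * (m * D) + 1 ≤
        ∑ j ∈ Finset.range (D + 1), (J (((12 * u * D : ℕ) : ℤ) - j * k).toNat).card))
    (cardβ : ℕ → ℕ) (hcardβ : ∀ D, cardβ D = ∑ jj ∈ Finset.range D, (J (bw D jj)).card) :
    (∀ b i, i ∈ J b → Even b ∧ 12 * i ≤ b ∧ b - 12 * i ≠ 2) ∧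
    (∀ D jj : ℕ, jj ≤ D → ((bw D jj : ℕ) : ℤ) = ((12 * u * D : ℕ) : ℤ) - jj * k) ∧
    (∀ D jj : ℕ, jj ≤ D → bw D jj ≤ 13 * u * D) ∧
    (∀ D, 1 ≤ D → 1 ≤ cardβ D) ∧
    (∀ D, 1 ≤ D → (cardβ D : ℝ) ≤ (24 * u : ℝ) ^ D) ∧
    (∀ m : ℕ, ∃ D : ℕ, 1 ≤ D ∧ m * D ≤ (cardβ D - 1) / 2) := by
  obtain ⟨hcard1, hcardQ, hgrow⟩ := hR6
  have hu1 : 1 ≤ u := by omega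
  have huk : |k| < u := by
    rw [hu, Int.abs_eq_natAbs]; push_cast; linarith
  have hJmem : ∀ b i, i ∈ J b → Even b ∧ 12 * i ≤ b ∧ b - 12 * i ≠ 2 := by
    intro b i hi
    rw [hJ] at hi
    split_ifs at hi with hb
    · rw [Finset.mem_filter, Finset.mem_range] at hi
      refine ⟨hb, ?_, hi.2⟩
      have := hi.1
      omega
    · simp at hi
  have hJcard : ∀ b, (J b).card ≤ b / 12 + 1 := by
    intro b
    rw [hJ]
    split_ifs
    · exact (Finset.card_filter_le _ _).trans (by rw [Finset.card_range])
    · simp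
  have hbw_nonneg : ∀ D jj : ℕ, jj ≤ D → (0 : ℤ) ≤ ((12 * u * D : ℕ) : ℤ) - jj * k := by
    intro D jj hjj
    have h1 : (jj : ℤ) * k ≤ jj * |k| := mul_le_mul_of_nonneg_left (le_abs_self k) (by positivity)
    have h2 : (jj : ℤ) * |k| ≤ D * u := by
      have : (jj : ℤ) ≤ D := by exact_mod_cast hjj
      nlinarith [abs_nonneg k]
    push_cast
    nlinarith
  have hbw_cast : ∀ D jj : ℕ, jj ≤ D → ((bw D jj : ℕ) : ℤ) = ((12 * u * D : ℕ) : ℤ) - jj * k := by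
    intro D jj hjj
    rw [hbw]
    exact Int.toNat_of_nonneg (hbw_nonneg D jj hjj)
  have hbw_le : ∀ D jj : ℕ, jj ≤ D → bw D jj ≤ 13 * u * D := by
    intro D jj hjj
    have h := hbw_cast D jj hjj
    have h2 : -((jj : ℤ) * k) ≤ D * (u - 1 : ℤ) := by
      have h1 : -((jj : ℤ) * k) ≤ jj * |k| := by
        have := mul_le_mul_of_nonneg_left (neg_le_abs k) (show (0 : ℤ) ≤ jj by positivity)
        linarith
      have hjj' : (jj : ℤ) ≤ D := by exact_mod_cast hjj
      have hku : |k| ≤ (u : ℤ) - 1 := by linarith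
      nlinarith [abs_nonneg k]
    have : ((bw D jj : ℕ) : ℤ) ≤ 13 * u * D := by
      rw [h]; push_cast; nlinarith
    exact_mod_cast this
  -- the split `Σ_{j ≤ D} = Σ_{j < D} + (j = D)`
  have hsplit : ∀ D, ∑ j ∈ Finset.range (D + 1), (J (((12 * u * D : ℕ) : ℤ) - j * k).toNat).card =
      cardβ D + (J (bw D D)).card := by
    intro D
    rw [hcardβ, Finset.sum_range_succ, hbw]
    congr 1
    exact Finset.sum_congr rfl fun jj _ ↦ by rw [hbw]
  refine ⟨hJmem, hbw_cast, hbw_le, ?_, ?_, ?_⟩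
  · -- `j = 0` contributes `i = 0`
    intro D hD
    rw [hcardβ]
    have h0 : 0 ∈ Finset.range D := Finset.mem_range.mpr hD
    have hJ0 : 1 ≤ (J (bw D 0)).card := by
      have hbw0 : bw D 0 = 12 * u * D := by
        rw [hbw]; simp only [Nat.cast_zero, zero_mul, sub_zero, Int.toNat_natCast]
      rw [hbw0, Finset.one_le_card]
      refine ⟨0, ?_⟩
      rw [hJ, if_pos (by exact ⟨6 * u * D, by ring⟩), Finset.mem_filter, Finset.mem_range]
      refine ⟨by omega, ?_⟩
      have : 12 ≤ 12 * u * D := by nlinarith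
      omega
    exact hJ0.trans (Finset.single_le_sum (f := fun jj ↦ (J (bw D jj)).card) (fun jj _ ↦ Nat.zero_le _) h0)
  · intro D hD
    refine le_trans ?_ (hcardQ D hD)
    have : cardβ D ≤ ∑ j ∈ Finset.range (D + 1), (J (((12 * u * D : ℕ) : ℤ) - j * k).toNat).card := by
      rw [hsplit]; omega
    exact_mod_cast this
  · intro m
    obtain ⟨D, hD, hmD⟩ := hgrow (m + u + 1)
    refine ⟨D, hD, ?_⟩
    have hJD : (J (bw D D)).card ≤ 13 * u * D / 12 + 1 :=
      (hJcard _).trans (by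
        have := Nat.div_le_div_right (c := 12) (hbw_le D D le_rfl)
        omega)
    have h13 : 13 * u * D / 12 + 1 ≤ 2 * u * D + 2 * D := by
      have h1 : 13 * u * D / 12 ≤ 2 * u * D := by
        apply Nat.div_le_of_le_mul; nlinarith
      omega
    have key : 2 * (m * D) + 1 ≤ cardβ D := by
      have e1 : 2 * ((m + u + 1) * D) + 1 ≤ cardβ D + (J (bw D D)).card := by
        rw [← hsplit]; exact hmD
      nlinarith
    omega

end Summit.Langlands.Langlands.Theorems.HilbertIntegralOverconvergentIsCongruence

end
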